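import Summits.CriticalPhenomena.PercolationContinuityZ3.Theorems.PercNearOneGluingNoHeavyQuantFlowGiantMin
import HarnessLib

/-!
# QUANT lane R8, T-DEC: THE POUR — moving giant-routed low mass into slot mids with spare capacity (`IsFlowAtT.pour`)

builds on p205010 (kernel theorem, internal audit signed; external expert review pending)

Support file (`--supports stmt-CriticalPhenomena-4575`), QUANT lane seat prim-quant-arm-1 (gen 39), rung R8 of
`run/shared/lean/prim/quant/LADDER.md`.  Theorems only (no definitions), standard axioms, no sorries.  Memo
`run/shared/lean/prim/quant/prim-quant-arm-1-g39/TWIN-MOVE-G39.md` §9 (the "competitor" of the primal proof of `LawDec.TwinMoveDEC`).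

THE LEMMA.  `φ` a flow witness of a law `Q` at `(x, T, j, M)` (`LawDec.IsFlowAtT`); a weight `s h ≥ 0` ("spare capacity") and a rate bound
`U h > 0` on a set of SLOT mids `h` (`h ≤ j`, `h ≤ M`, `T < h`, so every low is compatible with `h`) such that the slots are not over-full
(`load_φ h + s h ≤ Q h`) and every low pays at most `U h` there (`usage(l,h) ≤ U h`); off the slots `s = 0`.  Let `F = Σ_h s h / U h` (the low
mass the spare can certainly take) and `W = Σ_l Σ_{giants} φ l g` the giant-routed low mass.  Then for every `0 ≤ κ ≤ 1` with `κ·W ≤ F` there is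
a flow witness `φ′` of `Q` whose giant-routed mass is `(1 − κ)·W`: each low moves the fraction `κ` of its giant mass into the slots, split in
proportion to `s h / U h`.  (Used with the zero's vacated slots: `s h = usage_τ(0,h)·f(0,h)`, `U h = usage_τ(0,h)`, `F = F₀`.)

* **`LawDec.IsFlowAtT.pour`** — the statement above, with the new witness written out.

[this work]; nothing here is cited as a published result.  The gluing rows served [cite: KozmaNitzan2024, Conjecture 3 (p. 15)]; product measure
[cite: Grimmett1999, §1.3 p. 10].
-/

noncomputable section

namespace Summit.CriticalPhenomena.PercolationContinuityZ3.Theorems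

namespace Quant

open Finset

namespace LawDec

/-- **THE POUR.**  See the module docstring.  The new witness is
`φ′ l h = φ l h + κ·G l·(s h / U h)/F` on the slots and `(1−κ)·φ l h` on the giants (`G l = Σ_{giants} φ l g`), unchanged elsewhere;
its giant-routed mass is `(1−κ)·W`. [this work] -/
theorem IsFlowAtT.pour {x T : ℝ} {j M : ℕ} {Q : ℕ → ℝ} {φ : ℕ → ℕ → ℝ} (hφ : IsFlowAtT x T j M Q φ)
    (hx0 : 0 < x) (hx1 : x < 1) (s U : ℕ → ℝ) (hs0 : ∀ h, 0 ≤ s h) (hU : ∀ h, 0 < U h)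
    (hslot : ∀ h, 0 < s h → h ≤ j ∧ h ≤ M ∧ T < (h : ℝ))
    (hspare : ∀ h, 0 < s h → ∑ l ∈ Finset.range (j + 1), usage x T j l h * φ l h + s h ≤ Q h)
    (hrate : ∀ l h, 0 < s h → l ≤ j → 2 * (l : ℝ) < T → usage x T j l h ≤ U h)
    (κ : ℝ) (hκ0 : 0 ≤ κ) (hκ1 : κ ≤ 1)
    (hκF : κ * ∑ l ∈ Finset.range (j + 1), ∑ g ∈ Finset.Ico (j + 1) (M + 1), φ l g
      ≤ ∑ h ∈ Finset.range (M + 1), s h / U h) :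
    ∃ φ' : ℕ → ℕ → ℝ, IsFlowAtT x T j M Q φ' ∧
      ∑ l ∈ Finset.range (j + 1), ∑ g ∈ Finset.Ico (j + 1) (M + 1), φ' l g
        = (1 - κ) * ∑ l ∈ Finset.range (j + 1), ∑ g ∈ Finset.Ico (j + 1) (M + 1), φ l g := by
  classical
  obtain ⟨hφ0, hsupp, hrow, hcol⟩ := hφ
  set W : ℝ := ∑ l ∈ Finset.range (j + 1), ∑ g ∈ Finset.Ico (j + 1) (M + 1), φ l g with hW
  set F : ℝ := ∑ h ∈ Finset.range (M + 1), s h / U h with hF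
  -- giant mass of each low
  set G : ℕ → ℝ := fun l => ∑ g ∈ Finset.Ico (j + 1) (M + 1), φ l g with hG
  have hG0 : ∀ l, 0 ≤ G l := fun l => Finset.sum_nonneg fun g _ => hφ0 l g
  have hW0 : 0 ≤ W := Finset.sum_nonneg fun l _ => hG0 l
  have hF0 : 0 ≤ F := Finset.sum_nonneg fun h _ => div_nonneg (hs0 h) (hU h).le
  -- trivial case `κ·W = 0`: take `φ` itself when `κ = 0` or `W = 0`
  by_cases hκW : κ * W = 0
  · refine ⟨φ, ⟨hφ0, hsupp, hrow, hcol⟩, ?_⟩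
    rcases mul_eq_zero.1 hκW with hk | hw
    · rw [hk]; ring
    · rw [← hW, hw]; ring
  have hκpos : 0 < κ := lt_of_le_of_ne hκ0 (fun h => hκW (by rw [← h, zero_mul]))
  have hWpos : 0 < W := lt_of_le_of_ne hW0 (fun h => hκW (by rw [← h, mul_zero]))
  have hFpos : 0 < F := lt_of_lt_of_le (mul_pos hκpos hWpos) hκF
  -- the new witness
  set φ' : ℕ → ℕ → ℝ := fun l h =>
    if j + 1 ≤ h then (1 - κ) * φ l h else φ l h + κ * G l * (s h / U h) / F with hφ'
  have hextra0 : ∀ l h, 0 ≤ κ * G l * (s h / U h) / F := fun l h =>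
    div_nonneg (mul_nonneg (mul_nonneg hκ0 (hG0 l)) (div_nonneg (hs0 h) (hU h).le)) hF0
  -- a low with positive giant mass is a genuine low
  have hGlow : ∀ l, 0 < G l → l ≤ j ∧ 2 * (l : ℝ) < T := by
    intro l hl
    obtain ⟨g, hg, hpos⟩ := Finset.exists_lt_of_sum_lt (by simpa [hG] using hl : ∑ g ∈ Finset.Ico (j + 1) (M + 1), (0:ℝ) < ∑ g ∈ Finset.Ico (j + 1) (M + 1), φ l g)
    obtain ⟨hlj, hlow, _, _⟩ := hsupp l g hpos
    exact ⟨hlj, hlow⟩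
  refine ⟨φ', ⟨fun l h => ?_, fun l h hp => ?_, fun l hlj hlow => ?_, fun h hhM habs => ?_⟩, ?_⟩
  · -- nonnegativity
    simp only [hφ']
    split_ifs
    · exact mul_nonneg (by linarith) (hφ0 l h)
    · exact add_nonneg (hφ0 l h) (hextra0 l h)
  · -- support of charged pairs
    simp only [hφ'] at hp
    by_cases hg : j + 1 ≤ h
    · rw [if_pos hg] at hp
      have : 0 < φ l h := by
        by_contra hle
        have : φ l h = 0 := le_antisymm (not_lt.1 hle) (hφ0 l h)
        rw [this, mul_zero] at hp; exact lt_irrefl _ hp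
      exact hsupp l h this
    · rw [if_neg hg] at hp
      rcases (hφ0 l h).eq_or_lt with hz | hpos
      · -- only the poured part is positive: then `s h > 0` (a slot) and `G l > 0` (a low)
        rw [← hz, zero_add] at hp
        have hsh : 0 < s h := by
          by_contra hle
          have : s h = 0 := le_antisymm (not_lt.1 hle) (hs0 h)
          rw [this, zero_div, mul_zero, zero_div] at hp; exact lt_irrefl _ hp
        have hGl : 0 < G l := by
          by_contra hle
          have : G l = 0 := le_antisymm (not_lt.1 hle) (hG0 l)
          rw [this, mul_zero, zero_mul, zero_div] at hp; exact lt_irrefl _ hp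
        obtain ⟨hhj, hhM, hTh⟩ := hslot h hsh
        obtain ⟨hlj, hlow⟩ := hGlow l hGl
        exact ⟨hlj, hlow, hhM, Or.inr (by have : (0:ℝ) ≤ l := Nat.cast_nonneg l; linarith)⟩
      · exact hsupp l h hpos
  · -- rows: the poured mass `Σ_h κ G_l (s h/U h)/F = κ G_l` replaces the removed giant mass
    have hsplit : ∑ h ∈ Finset.range (M + 1), φ' l h
        = ∑ h ∈ Finset.range (M + 1), φ l h
          + (∑ h ∈ Finset.range (M + 1), (if j + 1 ≤ h then -(κ * φ l h) else κ * G l * (s h / U h) / F)) := by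
      rw [← Finset.sum_add_distrib]
      refine Finset.sum_congr rfl fun h _ => ?_
      simp only [hφ']
      split_ifs <;> ring
    have hcorr : ∑ h ∈ Finset.range (M + 1), (if j + 1 ≤ h then -(κ * φ l h) else κ * G l * (s h / U h) / F) = 0 := by
      have e : ∀ h ∈ Finset.range (M + 1), (if j + 1 ≤ h then -(κ * φ l h) else κ * G l * (s h / U h) / F)
          = (if j + 1 ≤ h then -(κ * φ l h) else 0) + (κ * G l / F) * (if j + 1 ≤ h then 0 else s h / U h) := by
        intro h _; split_ifs <;> ring
      rw [Finset.sum_congr rfl e, Finset.sum_add_distrib, ← Finset.mul_sum]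
      -- giants part
      have e1 : ∑ h ∈ Finset.range (M + 1), (if j + 1 ≤ h then -(κ * φ l h) else 0) = -(κ * G l) := by
        rw [← Finset.sum_filter]
        have : (Finset.range (M + 1)).filter (fun h => j + 1 ≤ h) = Finset.Ico (j + 1) (M + 1) := by
          ext h; simp only [Finset.mem_filter, Finset.mem_range, Finset.mem_Ico]; omega
        rw [this, hG, Finset.mul_sum, ← Finset.sum_neg_distrib]
      -- slots part: slots are `≤ j`, so the indicator is `s h / U h` everywhere it matters
      have e2 : ∑ h ∈ Finset.range (M + 1), (if j + 1 ≤ h then 0 else s h / U h) = F := by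
        rw [hF]
        refine Finset.sum_congr rfl fun h _ => ?_
        split_ifs with hg
        · rcases (hs0 h).eq_or_lt with hz | hpos
          · rw [← hz, zero_div]
          · have := (hslot h hpos).1; omega
        · rfl
      rw [e1, e2]
      field_simp
      ring
    rw [hsplit, hcorr, add_zero]
    exact hrow l hlj hlow
  · -- columns
    rcases habs with hg | hmid
    · -- a giant: load scaled by `(1 − κ) ≤ 1`
      have e : ∑ l ∈ Finset.range (j + 1), usage x T j l h * φ' l h
          = (1 - κ) * ∑ l ∈ Finset.range (j + 1), usage x T j l h * φ l h := by
        rw [Finset.mul_sum]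
        refine Finset.sum_congr rfl fun l _ => ?_
        simp only [hφ', if_pos hg]; ring
      rw [e]
      have hL0 : 0 ≤ ∑ l ∈ Finset.range (j + 1), usage x T j l h * φ l h :=
        Finset.sum_nonneg fun l _ => by
          rw [usage_giant_eq x T j l h hg]
          exact mul_nonneg (div_nonneg hx0.le (by linarith)) (hφ0 l h)
      calc (1 - κ) * ∑ l ∈ Finset.range (j + 1), usage x T j l h * φ l h
          ≤ 1 * ∑ l ∈ Finset.range (j + 1), usage x T j l h * φ l h := mul_le_mul_of_nonneg_right (by linarith) hL0
        _ ≤ Q h := by rw [one_mul]; exact hcol h hhM (Or.inl hg)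
    · by_cases hg : j + 1 ≤ h
      · -- (also a giant) same as above
        have e : ∑ l ∈ Finset.range (j + 1), usage x T j l h * φ' l h
            = (1 - κ) * ∑ l ∈ Finset.range (j + 1), usage x T j l h * φ l h := by
          rw [Finset.mul_sum]
          refine Finset.sum_congr rfl fun l _ => ?_
          simp only [hφ', if_pos hg]; ring
        rw [e]
        have hL0 : 0 ≤ ∑ l ∈ Finset.range (j + 1), usage x T j l h * φ l h :=
          Finset.sum_nonneg fun l _ => by
            rw [usage_giant_eq x T j l h hg]
            exact mul_nonneg (div_nonneg hx0.le (by linarith)) (hφ0 l h)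
        calc (1 - κ) * ∑ l ∈ Finset.range (j + 1), usage x T j l h * φ l h
            ≤ 1 * ∑ l ∈ Finset.range (j + 1), usage x T j l h * φ l h := mul_le_mul_of_nonneg_right (by linarith) hL0
          _ ≤ Q h := by rw [one_mul]; exact hcol h hhM (Or.inr hmid)
      · -- a mid: old load + poured load; the poured load is `≤ κ W s_h/F ≤ s_h`
        have e : ∑ l ∈ Finset.range (j + 1), usage x T j l h * φ' l h
            = ∑ l ∈ Finset.range (j + 1), usage x T j l h * φ l h
              + ∑ l ∈ Finset.range (j + 1), usage x T j l h * (κ * G l * (s h / U h) / F) := by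
          rw [← Finset.sum_add_distrib]
          refine Finset.sum_congr rfl fun l _ => ?_
          simp only [hφ', if_neg hg]; ring
        rw [e]
        rcases (hs0 h).eq_or_lt with hz | hsh
        · -- not a slot: nothing poured
          rw [← hz]; simp only [zero_div, mul_zero, zero_div, mul_zero, Finset.sum_const_zero, add_zero]
          exact hcol h hhM (Or.inr hmid)
        · have hpour : ∑ l ∈ Finset.range (j + 1), usage x T j l h * (κ * G l * (s h / U h) / F) ≤ s h := by
            -- each term ≤ U h · κ G_l (s h/U h)/F = κ G_l s_h / F; only lows carry `G l > 0`
            have hterm : ∀ l ∈ Finset.range (j + 1), usage x T j l h * (κ * G l * (s h / U h) / F) ≤ κ * G l * s h / F := by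
              intro l hl
              rcases (hG0 l).eq_or_lt with hz | hGl
              · rw [← hz]; simp
              · obtain ⟨hlj, hlow⟩ := hGlow l hGl
                have hu := hrate l h hsh hlj hlow
                have hu0 : 0 ≤ usage x T j l h := by
                  have hlh : l < h := by
                    have : (l : ℝ) < h := by linarith [(hslot h hsh).2.2]
                    exact_mod_cast this
                  exact (usage_pos_of_compat x T j l h hx0 hx1 hlow hlh (Or.inr (by
                    have : (0:ℝ) ≤ l := Nat.cast_nonneg l; linarith [(hslot h hsh).2.2]))).le
                have hUh := hU h
                calc usage x T j l h * (κ * G l * (s h / U h) / F)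
                    = (usage x T j l h / U h) * (κ * G l * s h / F) := by field_simp
                  _ ≤ 1 * (κ * G l * s h / F) :=
                      mul_le_mul_of_nonneg_right ((div_le_one hUh).2 hu)
                        (div_nonneg (mul_nonneg (mul_nonneg hκ0 hGl.le) (hs0 h)) hF0)
                  _ = κ * G l * s h / F := one_mul _
            refine (Finset.sum_le_sum hterm).trans ?_
            have e3 : ∑ l ∈ Finset.range (j + 1), κ * G l * s h / F = (κ * W) * s h / F := by
              rw [hW, Finset.mul_sum, Finset.sum_mul, Finset.sum_div]
            rw [e3, div_le_iff₀ hFpos]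
            have := mul_le_mul_of_nonneg_right hκF (hs0 h)
            linarith
          have := hspare h hsh
          linarith
  · -- the new giant mass
    have e : ∀ l ∈ Finset.range (j + 1), ∑ g ∈ Finset.Ico (j + 1) (M + 1), φ' l g = (1 - κ) * ∑ g ∈ Finset.Ico (j + 1) (M + 1), φ l g := by
      intro l _
      rw [Finset.mul_sum]
      refine Finset.sum_congr rfl fun g hg => ?_
      simp only [hφ', if_pos (Finset.mem_Ico.1 hg).1]
    rw [Finset.sum_congr rfl e, ← Finset.mul_sum]

end LawDec

end Quant

end Summit.CriticalPhenomena.PercolationContinuityZ3.Theorems
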